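import Literature.Computability.AlgebraicComplexity.BI17FundamentalInvariantTensors
import Mathlib.Analysis.SpecificLimits.Basic
import HarnessLib

/-!
# The polystability criterion for tensors, BI 2017 Prop. 4.8, is false as printed: a counterexample

P. Bürgisser, C. Ikenmeyer, *Fundamental invariants of orbit closures*, J. Algebra **477** (2017)
390–434 = arXiv:1511.02927 [BurgisserIkenmeyer2017], §4.2, Prop. 4.8 (TeX `main.tex` L1838–1890,
held text `paper:arxiv-1511.02927` p0016:L126): "Let the tensor `w ∈ ⊗³ℂ^m` satisfy the following
two properties: 1. There is a reductive subgroup `R` of `SL_m^3 ∩ stab(w)` such that the centralizer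
of `R` in `SL_m^3` is contained in `T_m^3`. 2. There is a probability distribution `α` on `supp(w)`
such that its marginals `α^1, α^2, α^3` are the uniform distributions on `[m]`. Then `w` is
polystable." The tree types its diagonal-`R` case as the named fact
`Literature.Computability.AlgebraicComplexity.BI2017_prop_4_8_diag`
(`BI17FundamentalInvariantTensors.lean`), with `α ≥ 0` supported INSIDE `supp(w)` — the literal
reading of "a probability distribution on `supp(w)`".

**This file proves `¬ BI2017_prop_4_8_diag` (`not_BI2017_prop_4_8_diag`).** The statement is false
as typed and as printed; the printed proof (L1858–1876) ends "… `⟨α¹,μ⟩ + ⟨α²,ν⟩ + ⟨α³,π⟩ = 0` …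
This implies `μ = ν = π = 0`", but from `μ_i + ν_j + π_k ≥ 0` on `supp(w)` and the vanishing of the
`α`-average one only gets `μ_i + ν_j + π_k = 0` on `supp(α)`: a diagonal one-parameter subgroup
acting trivially on `supp(α)` and with positive weight on `supp(w) ∖ supp(α)` survives. (The
argument is correct when `supp(α) = supp(w)`, which is the case of both applications in the paper,
Cor. 4.9 — `⟨m⟩` and `⟨n,n,n⟩`, both tree theorems by the Kempf–Ness route:
`BI2017_cor_4_9_unitTensor_holds`, `BurgisserIkenmeyer2017_cor49_matMulTensor_holds`.)

## The counterexample (`m = 3`)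

`w = ⟨3⟩ + e₀ ⊗ e₁ ⊗ e₂ = e₀₀₀ + e₁₁₁ + e₂₂₂ + e₀₁₂`.
* Hypothesis 2: `α = 1/3` on the three diagonal triples has uniform marginals (`supp α ⊊ supp w`).
* Hypothesis 1: `R :=` all triples of diagonal matrices in `SL_3(ℂ)^3` stabilizing `w` (a subgroup,
  `exists_diagonalStabilizer_subgroup`; it is the `3`-torus `a_i b_i c_i = 1`, `a₀ b₁ c₂ = 1`,
  `∏ a = ∏ b = ∏ c = 1`, hence diagonalizable, hence reductive — so the printed hypothesis holds as
  well). It contains `r₀ = (diag(2, 1/300, 150), diag(3, 5, 1/15), diag(1/6, 60, 1/10))`, whose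
  entries are pairwise distinct in each leg, so anything in `SL_3^3` commuting with `R` is a triple of
  diagonal matrices (`isDiag_of_commute_diagonal`).
* Not polystable: `λ(s) = (diag(s⁻¹,1,s), diag(s,s⁻¹,1), diag(1,s,s⁻¹)) ∈ SL_3(ℂ)^3` gives
  `λ(s)·w = ⟨3⟩ + s⁻³ e₀₁₂ → ⟨3⟩` (`s = n + 2 → ∞`; `actTensor_oneParam_cex`,
  `tendsto_actTensor_oneParam_cex`), so `⟨3⟩` lies in the closure of `SL³·w`; but `⟨3⟩ ∉ SL³·w`:
  if `(A ⊗ B ⊗ C)·w = ⟨3⟩` then for every `s` the leg-1 contraction of `w` against row `s` of `A`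
  is `B⁻¹ E_ss (Cᵀ)⁻¹`, a rank-`≤ 1` matrix (`slice_actTensor`, `mul_unitSlice_mul_apply`), while the
  contraction of `w` against `y` is `[[y₀,0,0],[0,y₁,y₀],[0,0,y₂]]`, of rank `≤ 1` only if `y₀ = 0`
  (`cex_slice_rankOne`); so the first column of `A` vanishes and `det A = 0 ≠ 1`.

Corrected hypothesis making Prop. 4.8 (and its proof) valid: `supp(α) = supp(w)`; the forms twin
Prop. 2.8 (L565) has the same gap ("`∑ c_α α = (1,…,1)`, `c_α ≥ 0` … This implies `μ_i = 0`"),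
corrected by requiring `c_α > 0` for all `α ∈ supp(w)`. Cell `val-lit`, row BI2017-B (erratum,
print-side). Honest framing: bookkeeping of BI 2017 §4.2; VP ≠ VNP is NOT proved and nothing here
bears on it.

## References

* [BurgisserIkenmeyer2017] P. Bürgisser, C. Ikenmeyer, *Fundamental invariants of orbit closures*,
  J. Algebra 477 (2017) 390–434; arXiv:1511.02927, §4.2, Prop. 4.8 and its proof.
-/

noncomputable section

open Filter
open scoped Topology

namespace Literature.Computability.AlgebraicComplexity

/-! ### General lemmas -/

section General

variable {ι : Type*} [Fintype ι] [DecidableEq ι]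

/-- A matrix commuting with a diagonal matrix whose entries are pairwise distinct is diagonal
(BI 2017, proof of Cor. 2.9 / Cor. 4.9, L600 and L1910: "`rg = gr`, which implies
`r_i g_{ij} = g_{ij} r_j`, hence `g_{ij} = 0`. So `g` must be diagonal").
[cite: BurgisserIkenmeyer2017, Cor. 4.9 (proof)] -/
theorem isDiag_of_commute_diagonal {M : Matrix ι ι ℂ} {d : ι → ℂ}
    (hd : ∀ i j, i ≠ j → d i ≠ d j) (h : M * Matrix.diagonal d = Matrix.diagonal d * M) :
    M.IsDiag := by
  unfold Matrix.IsDiag Pairwise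
  intro i j hij
  have h1 := congr_fun (congr_fun h i) j
  rw [Matrix.mul_diagonal, Matrix.diagonal_mul] at h1
  have h2 : M i j * (d j - d i) = 0 := by rw [mul_sub, h1]; ring
  rcases mul_eq_zero.mp h2 with h3 | h3
  · exact h3
  · exact absurd (sub_eq_zero.mp h3).symm (hd i j hij)

/-- A product of diagonal matrices is diagonal. [folklore] -/
private theorem isDiag_mul {A B : Matrix ι ι ℂ} (hA : A.IsDiag) (hB : B.IsDiag) : (A * B).IsDiag := by
  rw [← Matrix.IsDiag.diagonal_diag hA, ← Matrix.IsDiag.diagonal_diag hB,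
    Matrix.diagonal_mul_diagonal]
  exact Matrix.isDiag_diagonal _

/-- The triples of diagonal matrices in `SL(ι)³` stabilizing a tensor `w` form a subgroup (the
diagonal part of `SL³ ∩ stab(w)`, BI 2017 §4.2). [cite: BurgisserIkenmeyer2017, Prop. 4.8 / Cor. 4.9 (proof)] -/
theorem exists_diagonalStabilizer_subgroup (w : ι → ι → ι → ℂ) :
    ∃ R : Subgroup (Matrix.SpecialLinearGroup ι ℂ × Matrix.SpecialLinearGroup ι ℂ ×
      Matrix.SpecialLinearGroup ι ℂ),
      ∀ g, g ∈ R ↔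
        ((g.1 : Matrix ι ι ℂ).IsDiag ∧ (g.2.1 : Matrix ι ι ℂ).IsDiag ∧ (g.2.2 : Matrix ι ι ℂ).IsDiag ∧
          actTensor (g.1 : Matrix ι ι ℂ) (g.2.1 : Matrix ι ι ℂ) (g.2.2 : Matrix ι ι ℂ) w = w) := by
  classical
  set S : Set (Matrix.SpecialLinearGroup ι ℂ × Matrix.SpecialLinearGroup ι ℂ ×
      Matrix.SpecialLinearGroup ι ℂ) :=
    {g | (g.1 : Matrix ι ι ℂ).IsDiag ∧ (g.2.1 : Matrix ι ι ℂ).IsDiag ∧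
      (g.2.2 : Matrix ι ι ℂ).IsDiag ∧
      actTensor (g.1 : Matrix ι ι ℂ) (g.2.1 : Matrix ι ι ℂ) (g.2.2 : Matrix ι ι ℂ) w = w} with hS
  refine ⟨{ carrier := S, mul_mem' := ?_, one_mem' := ?_, inv_mem' := ?_ }, fun g => Iff.rfl⟩
  · rintro a b ⟨ha1, ha2, ha3, haw⟩ ⟨hb1, hb2, hb3, hbw⟩
    refine ⟨?_, ?_, ?_, ?_⟩
    · rw [Prod.fst_mul, Matrix.SpecialLinearGroup.coe_mul]; exact isDiag_mul ha1 hb1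
    · rw [Prod.snd_mul, Prod.fst_mul, Matrix.SpecialLinearGroup.coe_mul]; exact isDiag_mul ha2 hb2
    · rw [Prod.snd_mul, Prod.snd_mul, Matrix.SpecialLinearGroup.coe_mul]; exact isDiag_mul ha3 hb3
    · rw [Prod.fst_mul, Prod.snd_mul, Prod.fst_mul, Prod.snd_mul, Matrix.SpecialLinearGroup.coe_mul,
        Matrix.SpecialLinearGroup.coe_mul, Matrix.SpecialLinearGroup.coe_mul, ← actTensor_actTensor,
        hbw, haw]
  · refine ⟨?_, ?_, ?_, ?_⟩
    · rw [Prod.fst_one, Matrix.SpecialLinearGroup.coe_one]; exact Matrix.isDiag_one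
    · rw [Prod.snd_one, Prod.fst_one, Matrix.SpecialLinearGroup.coe_one]; exact Matrix.isDiag_one
    · rw [Prod.snd_one, Prod.snd_one, Matrix.SpecialLinearGroup.coe_one]; exact Matrix.isDiag_one
    · rw [Prod.fst_one, Prod.snd_one, Prod.fst_one, Prod.snd_one, Matrix.SpecialLinearGroup.coe_one]
      exact actTensor_one w
  · rintro g ⟨h1, h2, h3, hw⟩
    -- inverses of diagonal matrices of determinant one are diagonal (adjugates)
    have hinv : ∀ A : Matrix.SpecialLinearGroup ι ℂ, (A : Matrix ι ι ℂ).IsDiag →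
        ((A⁻¹ : Matrix.SpecialLinearGroup ι ℂ) : Matrix ι ι ℂ).IsDiag := by
      intro A hA
      rw [Matrix.SpecialLinearGroup.coe_inv, ← (Matrix.isDiag_iff_diagonal_diag _).mp hA,
        Matrix.adjugate_diagonal]
      exact Matrix.isDiag_diagonal _
    refine ⟨?_, ?_, ?_, ?_⟩
    · rw [Prod.fst_inv]; exact hinv _ h1
    · rw [Prod.snd_inv, Prod.fst_inv]; exact hinv _ h2
    · rw [Prod.snd_inv, Prod.snd_inv]; exact hinv _ h3
    · -- `g⁻¹·w = g⁻¹·(g·w) = w`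
      have hm : ∀ A : Matrix.SpecialLinearGroup ι ℂ,
          ((A⁻¹ : Matrix.SpecialLinearGroup ι ℂ) : Matrix ι ι ℂ) * (A : Matrix ι ι ℂ) = 1 := by
        intro A
        rw [← Matrix.SpecialLinearGroup.coe_mul, inv_mul_cancel, Matrix.SpecialLinearGroup.coe_one]
      rw [Prod.fst_inv, Prod.snd_inv, Prod.fst_inv, Prod.snd_inv]
      conv_lhs => rw [← hw]
      rw [actTensor_actTensor, hm, hm, hm, actTensor_one]

omit [DecidableEq ι] in
/-- **Leg-1 slices transform by sandwiching**: contracting `(A ⊗ B ⊗ C)·v` against `e_s` in the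
first leg gives `B · (contraction of v against row s of A) · Cᵀ`. [folklore] -/
private theorem slice_actTensor (A B C : Matrix ι ι ℂ) (v : ι → ι → ι → ℂ) (s : ι) :
    B * Matrix.of (fun b c => ∑ a, A s a * v a b c) * C.transpose =
      Matrix.of (fun j k => actTensor A B C v s j k) := by
  ext j k
  simp only [Matrix.mul_apply, Matrix.transpose_apply, Matrix.of_apply, actTensor_apply,
    Finset.sum_mul, Finset.mul_sum]
  calc ∑ c, ∑ b, ∑ a, B j b * (A s a * v a b c) * C k c
      = ∑ b, ∑ c, ∑ a, B j b * (A s a * v a b c) * C k c := Finset.sum_comm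
    _ = ∑ b, ∑ a, ∑ c, B j b * (A s a * v a b c) * C k c :=
        Finset.sum_congr rfl fun b _ => Finset.sum_comm
    _ = ∑ a, ∑ b, ∑ c, B j b * (A s a * v a b c) * C k c := Finset.sum_comm
    _ = ∑ a, ∑ b, ∑ c, A s a * B j b * C k c * v a b c :=
        Finset.sum_congr rfl fun a _ => Finset.sum_congr rfl fun b _ =>
          Finset.sum_congr rfl fun c _ => by ring

/-- Sandwiching the `s`-th slice `E_ss` of a unit tensor: `(X · E_ss · Y)_{bc} = X_{bs} Y_{sc}`,
a rank-`≤ 1` matrix. [folklore] -/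
private theorem mul_unitSlice_mul_apply {m : ℕ} (X Y : Matrix (Fin m) (Fin m) ℂ) (s b c : Fin m) :
    (X * Matrix.of (fun j k => unitTensor ℂ m s j k) * Y) b c = X b s * Y s c := by
  rw [Matrix.mul_apply, Finset.sum_eq_single s]
  · rw [Matrix.mul_apply, Finset.sum_eq_single s]
    · simp [Matrix.of_apply, unitTensor_apply]
    · intro j _ hj
      rw [Matrix.of_apply, unitTensor_apply, if_neg (fun h => hj h.1.symm), mul_zero]
    · intro h; exact absurd (Finset.mem_univ _) h
  · intro k _ hk
    rw [Matrix.mul_apply, Finset.sum_eq_zero, zero_mul]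
    intro j _
    rw [Matrix.of_apply, unitTensor_apply, if_neg, mul_zero]
    rintro ⟨h1, h2⟩
    exact hk (h1.trans h2).symm
  · intro h; exact absurd (Finset.mem_univ _) h

end General

/-! ### The counterexample tensor `w = ⟨3⟩ + e₀₁₂` -/

section Cex

/-- The diagonal triple `r₀ = (diag(2,1/300,150), diag(3,5,1/15), diag(1/6,60,1/10))` stabilizes
`w = ⟨3⟩ + e₀₁₂` (its weight is `1` on `supp(w)`). [cite: BurgisserIkenmeyer2017, Prop. 4.8 (counterexample)] -/
theorem actTensor_r0_cex (v : Fin 3 → Fin 3 → Fin 3 → ℂ)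
    (hv : ∀ a b c, v a b c = if (a = b ∧ b = c) ∨ (a = 0 ∧ b = 1 ∧ c = 2) then 1 else 0) :
    actTensor (Matrix.diagonal ![(2 : ℂ), 1 / 300, 150]) (Matrix.diagonal ![(3 : ℂ), 5, 1 / 15])
      (Matrix.diagonal ![(1 / 6 : ℂ), 60, 1 / 10]) v = v := by
  refine actTensor_diagonal_eq_self_of_support _ _ _ v fun a b c h => ?_
  rw [hv] at h
  have hc : (a = b ∧ b = c) ∨ (a = 0 ∧ b = 1 ∧ c = 2) := by
    by_contra hc; exact h (if_neg hc)
  rcases hc with ⟨rfl, rfl⟩ | ⟨rfl, rfl, rfl⟩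
  · fin_cases a <;> norm_num [Matrix.cons_val_two, Matrix.tail_cons, Matrix.head_cons]
  · norm_num [Matrix.cons_val_two, Matrix.tail_cons, Matrix.head_cons]

/-- The one-parameter family `λ(s) = (diag(s⁻¹,1,s), diag(s,s⁻¹,1), diag(1,s,s⁻¹))` moves
`w = ⟨3⟩ + e₀₁₂` to `⟨3⟩ + s⁻³ e₀₁₂`. [cite: BurgisserIkenmeyer2017, Prop. 4.8 (counterexample)] -/
theorem actTensor_oneParam_cex (v : Fin 3 → Fin 3 → Fin 3 → ℂ)
    (hv : ∀ a b c, v a b c = if (a = b ∧ b = c) ∨ (a = 0 ∧ b = 1 ∧ c = 2) then 1 else 0)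
    {s : ℂ} (hs : s ≠ 0) :
    actTensor (Matrix.diagonal ![s⁻¹, 1, s]) (Matrix.diagonal ![s, s⁻¹, 1])
        (Matrix.diagonal ![1, s, s⁻¹]) v =
      unitTensor ℂ 3 + (s⁻¹) ^ 3 • fun a b c => if a = 0 ∧ b = 1 ∧ c = 2 then (1 : ℂ) else 0 := by
  funext a b c
  rw [actTensor_diagonal_apply, hv, Pi.add_apply, Pi.add_apply, Pi.add_apply, Pi.smul_apply,
    Pi.smul_apply, Pi.smul_apply, unitTensor_apply, smul_eq_mul]
  fin_cases a <;> fin_cases b <;> fin_cases c <;> (simp [hs]; try ring)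

/-- Along `s = n + 2 → ∞`, `λ(s)·w → ⟨3⟩`: the unit tensor lies in the closure of `SL_3(ℂ)^3 · w`.
[cite: BurgisserIkenmeyer2017, Prop. 4.8 (counterexample)] -/
theorem tendsto_actTensor_oneParam_cex (v : Fin 3 → Fin 3 → Fin 3 → ℂ)
    (hv : ∀ a b c, v a b c = if (a = b ∧ b = c) ∨ (a = 0 ∧ b = 1 ∧ c = 2) then 1 else 0) :
    Tendsto (fun n : ℕ =>
      actTensor (Matrix.diagonal ![((n : ℂ) + 2)⁻¹, 1, (n : ℂ) + 2])
        (Matrix.diagonal ![(n : ℂ) + 2, ((n : ℂ) + 2)⁻¹, 1])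
        (Matrix.diagonal ![1, (n : ℂ) + 2, ((n : ℂ) + 2)⁻¹]) v) atTop (𝓝 (unitTensor ℂ 3)) := by
  have hs : ∀ n : ℕ, ((n : ℂ) + 2) ≠ 0 := fun n => by
    have : ((n + 2 : ℕ) : ℂ) ≠ 0 := Nat.cast_ne_zero.mpr (Nat.succ_ne_zero _)
    simpa using this
  have heq : (fun n : ℕ =>
      actTensor (Matrix.diagonal ![((n : ℂ) + 2)⁻¹, 1, (n : ℂ) + 2])
        (Matrix.diagonal ![(n : ℂ) + 2, ((n : ℂ) + 2)⁻¹, 1])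
        (Matrix.diagonal ![1, (n : ℂ) + 2, ((n : ℂ) + 2)⁻¹]) v) =
      fun n : ℕ => unitTensor ℂ 3 +
        ((((n : ℂ) + 2)⁻¹) ^ 3) • fun a b c => if a = 0 ∧ b = 1 ∧ c = 2 then (1 : ℂ) else 0 := by
    funext n
    exact actTensor_oneParam_cex v hv (hs n)
  rw [heq]
  have hlim : Tendsto (fun n : ℕ => (((n : ℂ) + 2)⁻¹) ^ 3) atTop (𝓝 0) := by
    have h1 : Tendsto (fun n : ℕ => ((n : ℂ) + 2)⁻¹) atTop (𝓝 0) := by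
      have h2 := (tendsto_inv_atTop_nhds_zero_nat (𝕜 := ℂ)).comp (tendsto_add_atTop_nat 2)
      refine h2.congr fun n => ?_
      simp [Function.comp]
    simpa using h1.pow 3
  have := (tendsto_const_nhds (x := unitTensor ℂ 3)).add
    (hlim.smul_const (fun a b c : Fin 3 => if a = 0 ∧ b = 1 ∧ c = 2 then (1 : ℂ) else 0))
  simpa using this

/-- The leg-1 contraction of `w = ⟨3⟩ + e₀₁₂` against `y` is `[[y₀,0,0],[0,y₁,y₀],[0,0,y₂]]`; it has
rank `≤ 1` (is of the form `p qᵀ`) only if `y₀ = 0`. [cite: BurgisserIkenmeyer2017, Prop. 4.8 (counterexample)] -/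
theorem cex_slice_rankOne (v : Fin 3 → Fin 3 → Fin 3 → ℂ)
    (hv : ∀ a b c, v a b c = if (a = b ∧ b = c) ∨ (a = 0 ∧ b = 1 ∧ c = 2) then 1 else 0)
    (y p q : Fin 3 → ℂ) (h : ∀ b c, ∑ a, y a * v a b c = p b * q c) : y 0 = 0 := by
  have e1 := h 0 0
  have e2 := h 1 2
  have e3 := h 0 2
  simp only [Fin.sum_univ_three, hv] at e1 e2 e3
  simp at e1 e2 e3
  -- e1 : y 0 = p 0 * q 0, e2 : y 0 = p 1 * q 2, e3 : p 0 = 0 ∨ q 2 = 0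
  rcases e3 with h0 | h0
  · rw [e1, h0, zero_mul]
  · rw [e2, h0, mul_zero]

/-- `⟨3⟩` is not in the `SL_3(ℂ)^3`-orbit of `w = ⟨3⟩ + e₀₁₂` (indeed not in its `GL³`-orbit:
`w` has border rank `3` but rank `> 3`). [cite: BurgisserIkenmeyer2017, Prop. 4.8 (counterexample)] -/
theorem actTensor_cex_ne_unitTensor (v : Fin 3 → Fin 3 → Fin 3 → ℂ)
    (hv : ∀ a b c, v a b c = if (a = b ∧ b = c) ∨ (a = 0 ∧ b = 1 ∧ c = 2) then 1 else 0)
    (A B C : Matrix (Fin 3) (Fin 3) ℂ) (hA : A.det = 1) (hB : B.det = 1) (hC : C.det = 1) :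
    actTensor A B C v ≠ unitTensor ℂ 3 := by
  intro hg
  -- every entry of the first column of `A` vanishes
  have hcol : ∀ s : Fin 3, A s 0 = 0 := by
    intro s
    have hBu : IsUnit B.det := by rw [hB]; exact isUnit_one
    have hCu : IsUnit C.transpose.det := by rw [Matrix.det_transpose, hC]; exact isUnit_one
    set M : Matrix (Fin 3) (Fin 3) ℂ := Matrix.of (fun b c => ∑ a, A s a * v a b c) with hM
    have h1 : B * M * C.transpose = Matrix.of (fun j k => unitTensor ℂ 3 s j k) := by
      rw [hM, slice_actTensor, hg]
    have h2 : M = B⁻¹ * Matrix.of (fun j k => unitTensor ℂ 3 s j k) * (C.transpose)⁻¹ := by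
      rw [← h1]
      calc M = (B⁻¹ * B) * M * (C.transpose * (C.transpose)⁻¹) := by
            rw [Matrix.nonsing_inv_mul B hBu, Matrix.mul_nonsing_inv _ hCu, one_mul, mul_one]
        _ = B⁻¹ * (B * M * C.transpose) * (C.transpose)⁻¹ := by
            simp only [Matrix.mul_assoc]
    refine cex_slice_rankOne v hv (fun a => A s a) (fun b => B⁻¹ b s)
      (fun c => (C.transpose)⁻¹ s c) fun b c => ?_
    have := congr_fun (congr_fun h2 b) c
    rw [hM, Matrix.of_apply] at this
    rw [this, mul_unitSlice_mul_apply]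
  have hdet : A.det = 0 := Matrix.det_eq_zero_of_column_eq_zero 0 hcol
  rw [hA] at hdet
  exact one_ne_zero hdet

/-- **BI 2017 Prop. 4.8 is false as printed (and as typed): `¬ BI2017_prop_4_8_diag`.**
Witness: `m = 3`, `w = ⟨3⟩ + e₀₁₂`, `R` = the diagonal part of `SL_3^3 ∩ stab(w)` (contains a
triple with pairwise distinct entries in each leg, so its centralizer is diagonal), `α = 1/3` on the
diagonal (uniform marginals, `supp α ⊊ supp w`); `w` is not polystable because `⟨3⟩` lies in the
closure of `SL³·w` but not in `SL³·w`. [cite: BurgisserIkenmeyer2017, Prop. 4.8 (counterexample)] -/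
theorem not_BI2017_prop_4_8_diag : ¬ BI2017_prop_4_8_diag := by
  intro hP
  set v : Fin 3 → Fin 3 → Fin 3 → ℂ :=
    fun a b c => if (a = b ∧ b = c) ∨ (a = 0 ∧ b = 1 ∧ c = 2) then 1 else 0 with hv_def
  have hv : ∀ a b c, v a b c = if (a = b ∧ b = c) ∨ (a = 0 ∧ b = 1 ∧ c = 2) then 1 else 0 :=
    fun _ _ _ => rfl
  obtain ⟨R, hR⟩ := exists_diagonalStabilizer_subgroup v
  -- the explicit element `r₀ ∈ R`
  have hd1 : (Matrix.diagonal ![(2 : ℂ), 1 / 300, 150]).det = 1 := by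
    norm_num [Matrix.det_diagonal, Fin.prod_univ_three, Matrix.cons_val_two, Matrix.tail_cons,
      Matrix.head_cons]
  have hd2 : (Matrix.diagonal ![(3 : ℂ), 5, 1 / 15]).det = 1 := by
    norm_num [Matrix.det_diagonal, Fin.prod_univ_three, Matrix.cons_val_two, Matrix.tail_cons,
      Matrix.head_cons]
  have hd3 : (Matrix.diagonal ![(1 / 6 : ℂ), 60, 1 / 10]).det = 1 := by
    norm_num [Matrix.det_diagonal, Fin.prod_univ_three, Matrix.cons_val_two, Matrix.tail_cons,
      Matrix.head_cons]
  set r₀ : Matrix.SpecialLinearGroup (Fin 3) ℂ × Matrix.SpecialLinearGroup (Fin 3) ℂ ×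
      Matrix.SpecialLinearGroup (Fin 3) ℂ := (⟨_, hd1⟩, ⟨_, hd2⟩, ⟨_, hd3⟩) with hr₀
  have hr₀R : r₀ ∈ R :=
    (hR r₀).mpr ⟨Matrix.isDiag_diagonal _, Matrix.isDiag_diagonal _, Matrix.isDiag_diagonal _,
      actTensor_r0_cex v hv⟩
  have hpoly : IsPolystableTensor v := by
    refine hP 3 v R (fun r hr => (hR r).mp hr) ?_ ?_
    · -- the centralizer of `R` in `SL³` is diagonal
      intro g hg
      have hc := hg r₀ hr₀R
      have h1 : (g.1 : Matrix (Fin 3) (Fin 3) ℂ) * Matrix.diagonal ![(2 : ℂ), 1 / 300, 150] =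
          Matrix.diagonal ![(2 : ℂ), 1 / 300, 150] * (g.1 : Matrix (Fin 3) (Fin 3) ℂ) := by
        have := congrArg (fun x => ((x.1 : Matrix.SpecialLinearGroup (Fin 3) ℂ) :
          Matrix (Fin 3) (Fin 3) ℂ)) hc
        simpa [hr₀] using this
      have h2 : (g.2.1 : Matrix (Fin 3) (Fin 3) ℂ) * Matrix.diagonal ![(3 : ℂ), 5, 1 / 15] =
          Matrix.diagonal ![(3 : ℂ), 5, 1 / 15] * (g.2.1 : Matrix (Fin 3) (Fin 3) ℂ) := by
        have := congrArg (fun x => ((x.2.1 : Matrix.SpecialLinearGroup (Fin 3) ℂ) :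
          Matrix (Fin 3) (Fin 3) ℂ)) hc
        simpa [hr₀] using this
      have h3 : (g.2.2 : Matrix (Fin 3) (Fin 3) ℂ) * Matrix.diagonal ![(1 / 6 : ℂ), 60, 1 / 10] =
          Matrix.diagonal ![(1 / 6 : ℂ), 60, 1 / 10] * (g.2.2 : Matrix (Fin 3) (Fin 3) ℂ) := by
        have := congrArg (fun x => ((x.2.2 : Matrix.SpecialLinearGroup (Fin 3) ℂ) :
          Matrix (Fin 3) (Fin 3) ℂ)) hc
        simpa [hr₀] using this
      refine ⟨isDiag_of_commute_diagonal ?_ h1, isDiag_of_commute_diagonal ?_ h2,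
        isDiag_of_commute_diagonal ?_ h3⟩
      · intro i j hij
        fin_cases i <;> fin_cases j <;>
          first | exact absurd rfl hij |
            norm_num [Matrix.cons_val_two, Matrix.tail_cons, Matrix.head_cons]
      · intro i j hij
        fin_cases i <;> fin_cases j <;>
          first | exact absurd rfl hij |
            norm_num [Matrix.cons_val_two, Matrix.tail_cons, Matrix.head_cons]
      · intro i j hij
        fin_cases i <;> fin_cases j <;>
          first | exact absurd rfl hij |
            norm_num [Matrix.cons_val_two, Matrix.tail_cons, Matrix.head_cons]
    · -- `α = 1/3` on the diagonal
      refine ⟨fun p => if p.1 = p.2.1 ∧ p.2.1 = p.2.2 then 1 / 3 else 0, ?_, ?_, ?_, ?_, ?_⟩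
      · intro p
        show (0 : ℚ) ≤ if p.1 = p.2.1 ∧ p.2.1 = p.2.2 then 1 / 3 else 0
        split_ifs <;> norm_num
      · intro p hp
        show (if p.1 = p.2.1 ∧ p.2.1 = p.2.2 then (1 / 3 : ℚ) else 0) = 0
        rw [if_neg]
        intro hc
        apply hp
        rw [mem_tensorSupport, hv, if_pos (Or.inl hc)]
        exact one_ne_zero
      · intro i; fin_cases i <;> simp [Fin.sum_univ_three]
      · intro j; fin_cases j <;> simp [Fin.sum_univ_three]
      · intro l; fin_cases l <;> simp [Fin.sum_univ_three]
  -- `⟨3⟩` lies in the closure of the orbit, hence in the orbit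
  have hs : ∀ n : ℕ, ((n : ℂ) + 2) ≠ 0 := fun n => by
    have : ((n + 2 : ℕ) : ℂ) ≠ 0 := Nat.cast_ne_zero.mpr (Nat.succ_ne_zero _)
    simpa using this
  have hD : ∀ (s : ℂ), s ≠ 0 → (Matrix.diagonal ![s⁻¹, 1, s]).det = 1 ∧
      (Matrix.diagonal ![s, s⁻¹, 1]).det = 1 ∧ (Matrix.diagonal ![1, s, s⁻¹]).det = 1 := by
    intro s hs0
    refine ⟨?_, ?_, ?_⟩ <;> rw [Matrix.det_diagonal, Fin.prod_univ_three] <;>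
      simp [hs0, Matrix.cons_val_two, Matrix.tail_cons, Matrix.head_cons]
  set gseq : ℕ → Matrix.SpecialLinearGroup (Fin 3) ℂ × Matrix.SpecialLinearGroup (Fin 3) ℂ ×
      Matrix.SpecialLinearGroup (Fin 3) ℂ := fun n =>
    (⟨_, (hD _ (hs n)).1⟩, ⟨_, (hD _ (hs n)).2.1⟩, ⟨_, (hD _ (hs n)).2.2⟩) with hgseq
  have hmem : unitTensor ℂ 3 ∈ closure (Set.range fun g : Matrix.SpecialLinearGroup (Fin 3) ℂ ×
      Matrix.SpecialLinearGroup (Fin 3) ℂ × Matrix.SpecialLinearGroup (Fin 3) ℂ =>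
        actTensor (g.1 : Matrix (Fin 3) (Fin 3) ℂ) (g.2.1 : Matrix (Fin 3) (Fin 3) ℂ)
          (g.2.2 : Matrix (Fin 3) (Fin 3) ℂ) v) := by
    refine mem_closure_of_tendsto (tendsto_actTensor_oneParam_cex v hv)
      (Eventually.of_forall fun n => ⟨gseq n, ?_⟩)
    simp [hgseq]
  rw [hpoly.closure_eq] at hmem
  obtain ⟨g, hg⟩ := hmem
  exact actTensor_cex_ne_unitTensor v hv _ _ _ g.1.2 g.2.1.2 g.2.2.2 hg

end Cex

end Literature.Computability.AlgebraicComplexity
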